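import Summits.KontsevichZagierPeriods.KontsevichZagierPeriods.Theorems.RootDecompQuadraticDescentSurdPairsP3

/-!
# Census pairs #1 #2 (ℚ(√−7) surd), #24 #28 (dilog), #36 #37 (weight one) DECIDED in `KZ.relations` (route `RootDecompQuadraticDescent`, instances of crux stmt-KontsevichZagierPeriods-28994 `DescentTwoQ` / stmt-4280 `KZDimTwo`) · part 4/6

Cell `decomp-kz`, lens 6 (decomp-kz-lens-6 g8): the LINEAR-FIBRE STRATUM of the weight-2 box census decided by rules 1+2 in dimension 2 — general lemma `linFibre` (unfolding `s = (α(x)y+β(x))/β(x)` into a log band) + ONE base substitution by the Möbius involution `κ(t) = (1−t)/(1+t)` (`rel_subst`) + `rel_trans`; `pair1`, `pair2` (the ℚ(√−7) live benchmarks of 28994 rev 7), `pair24`, `pair28`, `pair36`, `pair37` (the latter with four `RFun.stokes` steps, rational primitives); packaged `surdPairs_decided`, `surdPairs_descentTwoQ_instances` (∀ R ⊇ relations) and `surdPairs_of_kzDimTwo` BY NAME.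

Source: `HOME/decomp-kz-lens-6/g8/SurdPairs.lean` sha256 a3f0c2d08098ea3e (1516 l; critic decomp-kz-crit-1 g2 CLEARED 2026-08-30T08:39:24Z, std axioms), split into 6 modules by the landing seat decomp-kz-census-1 g7 (contexts re-opened per part; generic docstrings added where the source had none; the route file is imported only by the last part, which proves the `KZDimTwo` corollaries BY NAME).  No `sorry`; standard axioms.  References: [cite: KontsevichZagier2001, §1.2].
-/

noncomputable section

open MeasureTheory Set MvPolynomial

namespace Summit.KontsevichZagierPeriods.RootDecompQuadraticDescent.SurdPairs

open Literature.NumberTheory.Transcendental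
open Literature.NumberTheory.Transcendental.KZ
open Literature.ModelTheory.ExponentialFields (IsSemialgebraic)

-- PRIVATE copy (twin landed in …DarkPairs; dedup.landed): rel_double
/-- `[2T] ≡ 2·[T]` on the square. -/
private theorem rel_double (T T2 : RFun 2) (h : ∀ x ∈ cube 2, T2.fn x = T.fn x + T.fn x) :
    KZ.of T2.rep - 2 • KZ.of T.rep ∈ KZ.relations := by
  have h1 := rel_lin T2 T T h
  have : KZ.of T2.rep - 2 • KZ.of T.rep = KZ.of T2.rep - KZ.of T.rep - KZ.of T.rep := by abel
  rwa [this]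

-- PRIVATE copy (landed twin lives in a farm-unbuilt module; dedup.landed): snoc2_zero, snoc2_one, init2_zero
/-- `snoc2_zero`: auxiliary theorem of the lens-6 development «surd» (instances of 28994/4280) — see the module docstring; verbatim from the lens file. -/
@[simp] private theorem snoc2_zero (x : Fin 1 → ℝ) (t : ℝ) : (Fin.snoc x t : Fin 2 → ℝ) 0 = x 0 := rfl

/-- `snoc2_one`: auxiliary theorem of the lens-6 development «surd» (instances of 28994/4280) — see the module docstring; verbatim from the lens file. -/
@[simp] private theorem snoc2_one (x : Fin 1 → ℝ) (t : ℝ) : (Fin.snoc x t : Fin 2 → ℝ) 1 = t := rfl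

/-- `init2_zero`: auxiliary theorem of the lens-6 development «surd» (instances of 28994/4280) — see the module docstring; verbatim from the lens file. -/
@[simp] private theorem init2_zero (z : Fin 2 → ℝ) : Fin.init z 0 = z 0 := rfl

/-- `A24_band`: auxiliary theorem of the lens-6 development «surd» (instances of 28994/4280) — see the module docstring; verbatim from the lens file. -/
theorem A24_band : KZ.of (A24.rename (Equiv.swap 0 1)).rep - KZ.of (LB 0 1 W1 VA24) ∈ KZ.relations := by
  refine linFibre _ 1 (fun t => 1 + t) (fun t => 1 + 2 * t + t ^ 2) (1 + X 0) (1 + 2 * X 0 + X 0 ^ 2)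
    (fun z => by simp) (fun z => by simp) (by fun_prop) (by fun_prop)
    (fun t ht => by linarith [ht.1]) (fun t ht => by nlinarith [ht.1]) (fun z _ => ?_) W1
    (fun t _ => by simp [W1, w1F]) VA24 (fun t ht => ?_)
  · rw [RFun.fn_rename]
    simp only [RFun.fn, A24, QA24, map_add, map_mul, map_pow, map_ofNat, map_one, aeval_X,
      Function.comp_apply, Equiv.swap_apply_left, Equiv.swap_apply_right]
    ring
  · have h : (1 : ℝ) + t ≠ 0 := by linarith [ht.1]
    have h2 : (1 : ℝ) + 2 * t + t ^ 2 ≠ 0 := by nlinarith [ht.1]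
    show vA24F t = ((1 + t) + (1 + 2 * t + t ^ 2)) / (1 + 2 * t + t ^ 2)
    rw [vA24F, div_eq_div_iff h h2]
    ring

/-- `B24_band`: auxiliary theorem of the lens-6 development «surd» (instances of 28994/4280) — see the module docstring; verbatim from the lens file. -/
private theorem B24_band : KZ.of B24.rep - KZ.of (LB 0 1 W1 VB24) ∈ KZ.relations := by
  refine linFibre _ 1 (fun t => 1 + t) (fun _ => 2) (1 + X 0) 2
    (fun z => by simp) (fun z => by simp) (by fun_prop) (by fun_prop)
    (fun t ht => by linarith [ht.1]) (fun t _ => two_pos) (fun z _ => ?_) W1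
    (fun t _ => by simp [W1, w1F]) VB24 (fun t _ => by simp only [VB24, mkArg_v, vB24F]; ring)
  simp only [RFun.fn, B24, QB24, map_add, map_mul, map_ofNat, map_one, aeval_X]
  ring

/-- `A28_band`: auxiliary theorem of the lens-6 development «surd» (instances of 28994/4280) — see the module docstring; verbatim from the lens file. -/
private theorem A28_band : KZ.of A28.rep - KZ.of (LB 0 1 W1 VA28) ∈ KZ.relations := by
  refine linFibre _ 1 (fun t => 1 + t) (fun _ => 1) (1 + X 0) 1
    (fun z => by simp) (fun z => by simp) (by fun_prop) (by fun_prop)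
    (fun t ht => by linarith [ht.1]) (fun t _ => one_pos) (fun z _ => ?_) W1
    (fun t _ => by simp [W1, w1F]) VA28 (fun t _ => by simp only [VA28, mkArg_v, vA28F]; ring)
  simp only [RFun.fn, A28, QA28, map_add, map_mul, map_one, aeval_X]
  ring

/-- `B28_band`: auxiliary theorem of the lens-6 development «surd» (instances of 28994/4280) — see the module docstring; verbatim from the lens file. -/
theorem B28_band :
    KZ.of (B28two.rename (Equiv.swap 0 1)).rep - KZ.of (LB 0 1 W1 VB28) ∈ KZ.relations := by
  refine linFibre _ 2 (fun t => 2 + 2 * t) (fun t => 1 + 2 * t + t ^ 2) (2 + 2 * X 0)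
    (1 + 2 * X 0 + X 0 ^ 2) (fun z => by simp) (fun z => by simp) (by fun_prop) (by fun_prop)
    (fun t ht => by linarith [ht.1]) (fun t ht => by nlinarith [ht.1]) (fun z _ => ?_) W1
    (fun t ht => ?_) VB28 (fun t ht => ?_)
  · rw [RFun.fn_rename]
    simp only [RFun.fn, B28two, QB28, map_add, map_mul, map_pow, map_ofNat, map_one, aeval_X,
      Function.comp_apply, Equiv.swap_apply_left, Equiv.swap_apply_right]
    ring
  · have h : (1 : ℝ) + t ≠ 0 := by linarith [ht.1]
    have h2 : (2 : ℝ) + 2 * t ≠ 0 := by linarith [ht.1]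
    show w1F t = 2 / (2 + 2 * t)
    rw [w1F, div_eq_div_iff h h2]
    ring
  · have h : (1 : ℝ) + t ≠ 0 := by linarith [ht.1]
    have h2 : (1 : ℝ) + 2 * t + t ^ 2 ≠ 0 := by nlinarith [ht.1]
    show vB28F t = ((2 + 2 * t) + (1 + 2 * t + t ^ 2)) / (1 + 2 * t + t ^ 2)
    rw [vB28F, div_eq_div_iff h h2]
    ring

/-- **Census pair #24 DECIDED**: `[□², 1/(1+x+2y+xy+y²)] − [□², 1/(2+y+xy)] ∈ KZ.relations`
(`DILOG/DILOG`, known value `0.374052826…`, unexplained by folds): relabel, two linear-fibre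
unfoldings, the base involution `κ`. -/
theorem pair24 : KZ.of A24.rep - KZ.of B24.rep ∈ KZ.relations := by
  have h := sub_mem (sub_mem (add_mem (RFun.rel_rename A24 (Equiv.swap 0 1)) A24_band) subst24) B24_band
  convert h using 1
  abel

/-- **Census pair #28 DECIDED**: `[□², 1/(1+y+xy)] − 2·[□², 1/(1+2x+2y+2xy+y²)] ∈ KZ.relations`
(`DILOG/DILOG`, known value `0.614279333…`, unexplained by folds). -/
theorem pair28 : KZ.of A28.rep - 2 • KZ.of B28.rep ∈ KZ.relations := by
  have hd := rel_double B28 B28two fun x _ => by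
    simp only [B28, B28two, RFun.fn, map_one, map_ofNat]; ring
  have h := add_mem (sub_mem (sub_mem (sub_mem A28_band subst28) B28_band)
    (RFun.rel_rename B28two (Equiv.swap 0 1))) hd
  convert h using 1
  abel

/-- `pair24_equivalent`: auxiliary theorem of the lens-6 development «surd» (instances of 28994/4280) — see the module docstring; verbatim from the lens file. -/
theorem pair24_equivalent : KZ.Equivalent A24.rep B24.rep := pair24
/-- `[□², 1/(1+y+xy)] ≡ [□², 2/((1+y)(1+2x+y))]`. -/
theorem pair28_equivalent : KZ.Equivalent A28.rep B28two.rep := by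
  have hd := rel_double B28 B28two fun x _ => by
    simp only [B28, B28two, RFun.fn, map_one, map_ofNat]; ring
  have h := sub_mem pair28 hd
  show KZ.of A28.rep - KZ.of B28two.rep ∈ KZ.relations
  convert h using 1
  abel

/-- `pair24_value`: auxiliary theorem of the lens-6 development «surd» (instances of 28994/4280) — see the module docstring; verbatim from the lens file. -/
theorem pair24_value : A24.rep.value = B24.rep.value := KZ.Equivalent.value_eq_holds pair24_equivalent
/-- `pair28_value`: auxiliary theorem of the lens-6 development «surd» (instances of 28994/4280) — see the module docstring; verbatim from the lens file. -/
theorem pair28_value : A28.rep.value = B28two.rep.value :=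
  KZ.Equivalent.value_eq_holds pair28_equivalent

/-! ## §4c A weight-one pair by partial fractions and one reflection: census pair #36
(`W1/INDEP · known · UNEXPLAINED by folds`), `2·[□²,1/(1+y)] − 3·[□²,1/(2+y−y²)] ∈ KZ.relations`.

The reflection move `xᵢ ↦ 1 − xᵢ` is reproduced verbatim from gen 6 (`g6/DarkPairs.lean`, itself from
`Theorems/HermiteRigidityIslandComplementCubeReflection.lean`) so that this file depends on
Literature modules and the route file only. -/

/-- `reflect_reflect`: auxiliary theorem of the lens-6 development «surd» (instances of 28994/4280) — see the module docstring; verbatim from the lens file. -/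
private theorem reflect_reflect {M : ℕ} (i : Fin M) (x : Fin M → ℝ) :
    Function.update (Function.update x i (1 - x i)) i
        (1 - Function.update x i (1 - x i) i) = x := by
  funext j
  rcases eq_or_ne j i with rfl | hj
  · simp
  · simp [Function.update_of_ne hj]

/-- `image_reflect_cube`: auxiliary theorem of the lens-6 development «surd» (instances of 28994/4280) — see the module docstring; verbatim from the lens file. -/
private theorem image_reflect_cube {M : ℕ} (i : Fin M) :
    (fun x : Fin M → ℝ => Function.update x i (1 - x i)) '' cube M = cube M := by
  refine Subset.antisymm ?_ fun y hy => ?_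
  · rintro _ ⟨x, hx, rfl⟩
    exact KZ.update_mem_cube hx i (by linarith [(hx i).2]) (by linarith [(hx i).1])
  · refine ⟨Function.update y i (1 - y i),
      KZ.update_mem_cube hy i (by linarith [(hy i).2]) (by linarith [(hy i).1]), ?_⟩
    exact reflect_reflect i y

/-- `reflectDeriv_apply`: auxiliary theorem of the lens-6 development «surd» (instances of 28994/4280) — see the module docstring; verbatim from the lens file. -/
private theorem reflectDeriv_apply {M : ℕ} (i : Fin M) (v : Fin M → ℝ) (j : Fin M) :
    ((ContinuousLinearMap.id ℝ (Fin M → ℝ) -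
        ((2:ℝ) • ContinuousLinearMap.proj (R := ℝ) (φ := fun _ : Fin M => ℝ) i).smulRight
          (Pi.single i (1:ℝ) : Fin M → ℝ) : (Fin M → ℝ) →L[ℝ] (Fin M → ℝ))) v j = if j = i then -v i else v j := by
  simp only [sub_apply, ContinuousLinearMap.id_apply, ContinuousLinearMap.smulRight_apply,
    smul_apply, ContinuousLinearMap.proj_apply, Pi.sub_apply, Pi.smul_apply, smul_eq_mul,
    Pi.single_apply, mul_ite, mul_one, mul_zero]
  split_ifs with hj
  · subst hj; ring
  · ring

/-- `abs_det_reflectDeriv`: auxiliary theorem of the lens-6 development «surd» (instances of 28994/4280) — see the module docstring; verbatim from the lens file. -/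
private theorem abs_det_reflectDeriv {M : ℕ} (i : Fin M) :
    |((ContinuousLinearMap.id ℝ (Fin M → ℝ) -
        ((2:ℝ) • ContinuousLinearMap.proj (R := ℝ) (φ := fun _ : Fin M => ℝ) i).smulRight
          (Pi.single i (1:ℝ) : Fin M → ℝ) : (Fin M → ℝ) →L[ℝ] (Fin M → ℝ))).det| = 1 := by
  set L := (ContinuousLinearMap.id ℝ (Fin M → ℝ) -
    ((2:ℝ) • ContinuousLinearMap.proj (R := ℝ) (φ := fun _ : Fin M => ℝ) i).smulRight
      (Pi.single i (1:ℝ) : Fin M → ℝ) : (Fin M → ℝ) →L[ℝ] (Fin M → ℝ)) with hL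
  have hinv : (L : (Fin M → ℝ) →ₗ[ℝ] (Fin M → ℝ)).comp (L : (Fin M → ℝ) →ₗ[ℝ] (Fin M → ℝ)) =
      LinearMap.id := by
    refine LinearMap.ext fun v => funext fun j => ?_
    rw [LinearMap.comp_apply, ContinuousLinearMap.coe_coe, LinearMap.id_apply, hL,
      reflectDeriv_apply, reflectDeriv_apply]
    rcases eq_or_ne j i with rfl | hj
    · simp
    · simp [hj]
  have h := congrArg LinearMap.det hinv
  rw [LinearMap.det_comp, LinearMap.det_id] at h
  rw [ContinuousLinearMap.det]
  rcases mul_self_eq_one_iff.mp h with h1 | h1 <;> simp [h1]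

/-- `hasFDerivAt_reflect`: auxiliary theorem of the lens-6 development «surd» (instances of 28994/4280) — see the module docstring; verbatim from the lens file. -/
private theorem hasFDerivAt_reflect {M : ℕ} (i : Fin M) (x : Fin M → ℝ) :
    HasFDerivAt (fun y : Fin M → ℝ => Function.update y i (1 - y i))
      ((ContinuousLinearMap.id ℝ (Fin M → ℝ) -
        ((2:ℝ) • ContinuousLinearMap.proj (R := ℝ) (φ := fun _ : Fin M => ℝ) i).smulRight
          (Pi.single i (1:ℝ) : Fin M → ℝ) : (Fin M → ℝ) →L[ℝ] (Fin M → ℝ))) x := by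
  have h0 : HasFDerivAt (fun y : Fin M → ℝ => 2 * y i - 1)
      ((2:ℝ) • ContinuousLinearMap.proj (R := ℝ) (φ := fun _ : Fin M => ℝ) i) x :=
    ((hasFDerivAt_apply i x).const_mul (2:ℝ)).sub_const 1
  have h1 := (hasFDerivAt_id x).sub (h0.smul_const (Pi.single i (1:ℝ)))
  refine h1.congr_of_eventuallyEq (Filter.Eventually.of_forall fun y => ?_)
  funext j
  simp only [Pi.sub_apply, id_eq, Pi.smul_apply, Pi.single_apply, smul_eq_mul, mul_ite, mul_one,
    mul_zero, Function.update_apply]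
  split_ifs with hj
  · subst hj; ring
  · ring

/-- `isSemialgebraicMapOn_reflect`: auxiliary theorem of the lens-6 development «surd» (instances of 28994/4280) — see the module docstring; verbatim from the lens file. -/
private theorem isSemialgebraicMapOn_reflect {M : ℕ} (i : Fin M) :
    IsSemialgebraicMapOn ℚ (cube M) (fun y : Fin M → ℝ => Function.update y i (1 - y i)) := by
  refine (isSemialgebraicMapOn_aeval isSemialgebraic_cube
    (Function.update (fun j => (X j : MvPolynomial (Fin M) ℚ)) i (1 - X i))).congr fun x _ => ?_
  funext j
  rcases eq_or_ne j i with rfl | hj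
  · simp
  · simp [Function.update_of_ne hj]

/-- The reflection move for tame cube representations. [cite: KontsevichZagier2001, §1.2 rule (2)] -/
private theorem rel_reflect_rep (M : ℕ) (i : Fin M) (r r' : IntegralRep M) (hr : r.IsTameCube)
    (hr' : r'.IsTameCube)
    (h : ∀ x ∈ cube M, r.integrand x = r'.integrand (Function.update x i (1 - x i))) :
    KZ.of r - KZ.of r' ∈ KZ.relations := by
  refine cubicalCovGens_subset_relations (mem_cubicalCovGens hr hr'
    (Φ := fun y : Fin M → ℝ => Function.update y i (1 - y i))
    (Φ' := fun _ => (ContinuousLinearMap.id ℝ (Fin M → ℝ) -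
        ((2:ℝ) • ContinuousLinearMap.proj (R := ℝ) (φ := fun _ : Fin M => ℝ) i).smulRight
          (Pi.single i (1:ℝ) : Fin M → ℝ) : (Fin M → ℝ) →L[ℝ] (Fin M → ℝ)))
    (isSemialgebraicMapOn_reflect i) (fun x _ => (hasFDerivAt_reflect i x).hasFDerivWithinAt)
    (fun x _ y _ hxy => ?_) (image_reflect_cube i) (fun j => ?_) fun x hx => ?_)
  · have hx := reflect_reflect i x
    have hy := reflect_reflect i y
    simp only at hxy
    rw [← hx, ← hy, hxy]
  · rcases eq_or_ne j i with rfl | hj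
    · simp only [Function.update_self]
      exact fun x _ => analyticAt_const.sub
        ((ContinuousLinearMap.proj (R := ℝ) (φ := fun _ : Fin M => ℝ) j).analyticAt x)
    · simp only [Function.update_of_ne hj]
      exact fun x _ => (ContinuousLinearMap.proj (R := ℝ) (φ := fun _ : Fin M => ℝ) j).analyticAt x
  · rw [abs_det_reflectDeriv, mul_one]
    exact h x hx

/-- **The reflection move for regular rational functions**: `S(x) = T(x with xᵢ := 1 − xᵢ)` on the
cube gives `[□ᴹ, S] − [□ᴹ, T] ∈ KZ.relations`. [cite: KontsevichZagier2001, §1.2 rule (2)] -/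
private theorem rel_reflect {M : ℕ} (i : Fin M) (T S : RFun M)
    (h : ∀ x ∈ cube M, S.fn x = T.fn (Function.update x i (1 - x i))) :
    KZ.of S.rep - KZ.of T.rep ∈ KZ.relations :=
  rel_reflect_rep M i S.rep T.rep S.isTameCube_rep T.isTameCube_rep h

/-! ## Small tools -/

/-- `update_zero_apply_one`: auxiliary theorem of the lens-6 development «surd» (instances of 28994/4280) — see the module docstring; verbatim from the lens file. -/
@[simp] private theorem update_zero_apply_one (x : Fin 2 → ℝ) (a : ℝ) : Function.update x 0 a 1 = x 1 :=
  Function.update_of_ne (by decide) a x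

/-- `update_one_apply_zero`: auxiliary theorem of the lens-6 development «surd» (instances of 28994/4280) — see the module docstring; verbatim from the lens file. -/
@[simp] private theorem update_one_apply_zero (x : Fin 2 → ℝ) (a : ℝ) : Function.update x 1 a 0 = x 0 :=
  Function.update_of_ne (by decide) a x

/-- `[3T] ≡ 3·[T]` on the square (rule 1b twice). -/
theorem rel_triple (T T2 T3 : RFun 2) (h2 : ∀ x ∈ cube 2, T2.fn x = T.fn x + T.fn x)
    (h3 : ∀ x ∈ cube 2, T3.fn x = T.fn x + T2.fn x) :
    KZ.of T3.rep - 3 • KZ.of T.rep ∈ KZ.relations := by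
  have h := add_mem (rel_lin T3 T T2 h3) (rel_double T T2 h2)
  convert h using 1
  abel

/-- `2 + y − y² = (1+y)(2−y)` (census pair #36, second member). -/
def QT36 : MvPolynomial (Fin 2) ℚ := 2 + X 1 - X 1 ^ 2

/-- `QT36_pos`: auxiliary theorem of the lens-6 development «surd» (instances of 28994/4280) — see the module docstring; verbatim from the lens file. -/
private theorem QT36_pos {x : Fin 2 → ℝ} (hx : x ∈ cube 2) : 0 < aeval x QT36 := by
  have h1 := (hx 1).1; have h1' := (hx 1).2
  simp only [QT36, map_add, map_sub, map_pow, map_ofNat, aeval_X]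
  nlinarith

/-- `[□², 1/(2+y−y²)]`, `[□², 2/(2+y−y²)]`, `[□², 3/(2+y−y²)]`. -/
def T36 : RFun 2 := ⟨1, QT36, fun _ hx => (QT36_pos hx).ne'⟩
/-- `T36two`: auxiliary def of the lens-6 development «surd» (instances of 28994/4280) — see the module docstring; verbatim from the lens file. -/
def T36two : RFun 2 := ⟨2, QT36, fun _ hx => (QT36_pos hx).ne'⟩
/-- `T36three`: auxiliary def of the lens-6 development «surd» (instances of 28994/4280) — see the module docstring; verbatim from the lens file. -/
def T36three : RFun 2 := ⟨3, QT36, fun _ hx => (QT36_pos hx).ne'⟩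
/-- `[□², 1/(1+y)]`, `[□², 2/(1+y)]` and the reflected `[□², 1/(2−y)]`. -/
def P36 : RFun 2 := ⟨1, 1 + X 1, fun x hx => by
  have h1 := (hx 1).1; simp only [map_add, map_one, aeval_X]; exact (by linarith : (0:ℝ) < 1 + x 1).ne'⟩
/-- `P36two`: auxiliary def of the lens-6 development «surd» (instances of 28994/4280) — see the module docstring; verbatim from the lens file. -/
def P36two : RFun 2 := ⟨2, 1 + X 1, fun x hx => by
  have h1 := (hx 1).1; simp only [map_add, map_one, aeval_X]; exact (by linarith : (0:ℝ) < 1 + x 1).ne'⟩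
/-- `R36`: auxiliary def of the lens-6 development «surd» (instances of 28994/4280) — see the module docstring; verbatim from the lens file. -/
def R36 : RFun 2 := ⟨1, 2 - X 1, fun x hx => by
  have h1 := (hx 1).2; simp only [map_sub, map_ofNat, aeval_X]; exact (by linarith : (0:ℝ) < 2 - x 1).ne'⟩

/-- Partial fractions (rule 1b): `[□², 3/((1+y)(2−y))] ≡ [□², 1/(1+y)] + [□², 1/(2−y)]`. -/
theorem T36_split : KZ.of T36three.rep - KZ.of P36.rep - KZ.of R36.rep ∈ KZ.relations := by
  refine rel_lin T36three P36 R36 fun x hx => ?_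
  have h1 := (hx 1).1; have h1' := (hx 1).2
  have ha : (1 : ℝ) + x 1 ≠ 0 := by linarith
  have hb : (2 : ℝ) - x 1 ≠ 0 := by linarith
  have hq : (2 : ℝ) + x 1 - x 1 ^ 2 ≠ 0 := by nlinarith
  simp only [RFun.fn, T36three, P36, R36, QT36, map_add, map_sub, map_pow, map_ofNat, map_one,
    aeval_X]
  rw [div_add_div _ _ ha hb, div_eq_div_iff hq (mul_ne_zero ha hb)]
  ring

/-- The reflection `y ↦ 1 − y` (rule 2): `[□², 1/(2−y)] ≡ [□², 1/(1+y)]`. -/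
private theorem R36_reflect : KZ.of R36.rep - KZ.of P36.rep ∈ KZ.relations := by
  refine rel_reflect 1 P36 R36 fun x _ => ?_
  simp only [RFun.fn, R36, P36, map_add, map_sub, map_ofNat, map_one, aeval_X, Function.update_self]
  ring

/-- **Census pair #36 DECIDED**: `2·[□², 1/(1+y)] − 3·[□², 1/(2+y−y²)] ∈ KZ.relations`
(`W1/INDEP`, value `0`·: `2 log 2 = 3 · (1/3)(log 2 + log 2)`): tripling, partial fractions, one
reflection — four moves of rules 1–2. -/
theorem pair36 : 2 • KZ.of P36.rep - 3 • KZ.of T36.rep ∈ KZ.relations := by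
  have e1 := rel_triple T36 T36two T36three (fun x _ => by simp only [RFun.fn, T36, T36two, map_one, map_ofNat]; ring)
    (fun x _ => by simp only [RFun.fn, T36, T36two, T36three, map_one, map_ofNat]; ring)
  have h := sub_mem (sub_mem e1 T36_split) R36_reflect
  convert h using 1
  abel

/-- `[□², 2/(1+y)] ≡ [□², 3/(2+y−y²)]`. -/
theorem pair36_equivalent : KZ.Equivalent P36two.rep T36three.rep := by
  have e1 := rel_triple T36 T36two T36three (fun x _ => by simp only [RFun.fn, T36, T36two, map_one, map_ofNat]; ring)
    (fun x _ => by simp only [RFun.fn, T36, T36two, T36three, map_one, map_ofNat]; ring)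
  have e2 := rel_double P36 P36two fun x _ => by simp only [RFun.fn, P36, P36two, map_one, map_ofNat]; ring
  have h := sub_mem (add_mem pair36 e2) e1
  show KZ.of P36two.rep - KZ.of T36three.rep ∈ KZ.relations
  convert h using 1
  abel

/-- `pair36_value`: auxiliary theorem of the lens-6 development «surd» (instances of 28994/4280) — see the module docstring; verbatim from the lens file. -/
theorem pair36_value : P36two.rep.value = T36three.rep.value :=
  KZ.Equivalent.value_eq_holds pair36_equivalent

end Summit.KontsevichZagierPeriods.RootDecompQuadraticDescent.SurdPairs

end
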